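import Literature.AnabelianGeometry.EtaleTheta.Discharge.Sec5OfConnectedTemperoid

/-!
# [EtTh] §5 over `B^temp(Π^tp_X)⁰` with `A_⊙^bs := Ÿ`: `Facts` from `hconst` and `hgc` alone; the divisor inputs from `Div(Θ̈)_±` (§5, pp.330–331 / PDF pp.104–105)

Mochizuki, *The étale theta function …*, Publ. RIMS **45** (2009)
[cite: MochizukiEtTh2009, §5 p.330–331 (PDF pp.104–105); Lem 5.8 p.331 (PDF p.105)].  Seat abc-iut-L2-t4 (§5 owner), ROW W3-L2-01
«§5 GENUINE DATA»; PROOF-ONLY corollaries of `Discharge/Sec5OfConnectedTemperoid.lean` (p427614).  Additive.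

For the §5 data over the canonical setting `BiKummerSetting.mkOfConnectedTemperoidYdd` (genuine connected base `B^temp(Π^tp_X)⁰`,
`A_⊙ := (Π^tp_X/ιX(Π^tp_Ÿ), 0)`, i.e. `A_⊙^bs := Ÿ`) the binder `hH` is the theorem `hH_mkOfConnectedTemperoidYdd`; hence:
* `ThetaFrobenioid.facts_ofConnectedTemperoidYddData` — the bundle `Facts` of §5 named inputs from the TWO printed inputs `hconst`
  (Def. 3.6 (iii): constants are `Aut`-fixed) and `hgc` (Lemma 5.8's geometric connectedness: a unit of `B_N` commuting with
  `s^⊓-gp_N(Π^tp_Y)` is a constant) — `hopen`, `hσ`, `hH`, Prop. 4.3 (iii), the defining relations, Aut-ampleness, total epimorphicity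
  and `ConstantsActByCyclotome` all being THEOREMS;
* `ThetaFrobenioid.facts_ofConnectedTemperoidYddData_thetaDivisor` — the same with the divisor inputs `hinvc`/`hinvp` SUPPLIED by
  `hinvc_ofConnectedTemperoid`/`hinvp_ofConnectedTemperoid` from the `Π^tp_X`-stability `hθ`/`hθ'` of `Div(s')`/`Div(s'')` of the
  fraction-pair of `Θ̈` on `A_⊙` (Prop. 4.3 (i) proof p.317; §5 p.330): the §5 data over `B^temp(Π^tp_X)⁰` with inputs EXACTLY
  `h, Q, (Rl, R), ιX, (K', constEmb), hθ, hθ', hconst, hgc` satisfy `Facts`.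
HONEST FRAMING: kernel-checked implications over abc-iut-L2-t3's / abc-iut-L3's data structures; no side taken downstream.
-/

noncomputable section

namespace Literature.AnabelianGeometry.EtaleTheta

open CategoryTheory Opposite Literature.AlgebraicGeometry.Frobenioids Literature.AnabelianGeometry.SemiGraphs
  Literature.AnabelianGeometry.SemiGraphs.GaloisObjects

universe u₀ v₀ w

namespace ThetaFrobenioid

variable {K : Type u₀} [Field K] {X : SemiGraphs.TemperedArithmeticGroup.{u₀} K} {D₀ : Type u₀} [Category.{v₀} D₀]
  {V : FrdIMonoidStub.{w}} {T₀ : RealifiedDivisorMonoids (D₀ := D₀) V}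
  {VD : FrdICatStub.{u₀ + 1, u₀, w} (ConnectedPart (BTemp X.Pi))}
  {tf : TemperedFrobenioid T₀ (ConnectedPart (BTemp X.Pi)) VD} {hZ : tf.monoidType = MonoidType.Z}
  {hP : ∀ A : (ConnectedPart (BTemp X.Pi))ᵒᵖ, IsPerfect (tf.Φ.carrier A)}
  {NH : Subgroup (Field.absoluteGaloisGroup K) → tf.category → ℕ+ → Prop}
  {lv N : ℕ+} {T : ThetaEnvData.{max u₀ w} N} {ιX : T.PiX ≃ₜ* X.Pi}
  {pullFrac : ∀ {A A' : (BiKummerSetting.mkOfConnectedTemperoidYdd X tf hZ hP NH T ιX).C} (_ : A' ⟶ A),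
    (BiKummerSetting.mkOfConnectedTemperoidYdd X tf hZ hP NH T ιX).biratUnits A →
      (BiKummerSetting.mkOfConnectedTemperoidYdd X tf hZ hP NH T ιX).biratUnits A'}
  {θ : (BiKummerSetting.mkOfConnectedTemperoidYdd X tf hZ hP NH T ιX).biratUnits
    (BiKummerSetting.mkOfConnectedTemperoidYdd X tf hZ hP NH T ιX).Aodot}
  {Bl : (BiKummerSetting.mkOfConnectedTemperoidYdd X tf hZ hP NH T ιX).C}
  {Pl : (BiKummerSetting.mkOfConnectedTemperoidYdd X tf hZ hP NH T ιX).FractionPair θ Bl}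
  {Rl : (BiKummerSetting.mkOfConnectedTemperoidYdd X tf hZ hP NH T ιX).NthRoot θ Pl lv pullFrac}
  (h : ModelFrobenioid.Hypotheses tf.divisorMonoid tf.ratFnFunctor)
  (Q : FrobenioidTheta.ThetaSubquotientStub.{w} (ConnectedPart (BTemp X.Pi))) (odd_l : Odd (lv : ℕ))
  (R : (BiKummerSetting.mkOfConnectedTemperoidYdd X tf hZ hP NH T ιX).NthRoot Rl.root Rl.pair N pullFrac)
  (K' : Type w) [Field K'] (constEmb : K'ˣ →* tf.biratUnitsModel R.BN) (constEmb_injective : Function.Injective constEmb)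

section General

variable
  (hinvc : ∀ g : Aut R.AN.base,
    pull tf.divisorMonoid g.hom (ModelFrobenioid.div R.pair.num) = ModelFrobenioid.div R.pair.num)
  (hinvp : ∀ y : T.PiX, y ∈ T.PiYdd →
    pull tf.divisorMonoid ((BiKummerSetting.mkOfConnectedTemperoidYdd X tf hZ hP NH T ιX).galoisSurj R.AN.base
      R.αData.isGalois (ιX y)).hom (ModelFrobenioid.div R.pair.den) = ModelFrobenioid.div R.pair.den)

/-- **`Facts` for the §5 data over `B^temp(Π^tp_X)⁰` with `A_⊙^bs := Ÿ`, from `hconst` (Def. 3.6 (iii)) and `hgc` (Lemma 5.8's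
geometric connectedness) ALONE** (`hH := hH_mkOfConnectedTemperoidYdd`).  [cite: MochizukiEtTh2009, §5 p.330–331 (PDF pp.104–105); Lem 5.8 p.331 (PDF p.105)] -/
theorem facts_ofConnectedTemperoidYddData
    (hconst : ∀ (e : Aut R.BN) (k : K'ˣ), tf.biratAutModel R.BN e (constEmb k) = constEmb k)
    (hgc : ∀ u : (ofConnectedTemperoidData h Q odd_l R ιX K' constEmb constEmb_injective hinvc hinvp).units
        (ofConnectedTemperoidData h Q odd_l R ιX K' constEmb constEmb_injective hinvc hinvp).BN,
      (∀ y ∈ (ofConnectedTemperoidData h Q odd_l R ιX K' constEmb constEmb_injective hinvc hinvp).imPiY,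
        (ofConnectedTemperoidData h Q odd_l R ιX K' constEmb constEmb_injective hinvc hinvp).sgpCap y *
          (u : Aut (ofConnectedTemperoidData h Q odd_l R ιX K' constEmb constEmb_injective hinvc hinvp).BN) *
          ((ofConnectedTemperoidData h Q odd_l R ιX K' constEmb constEmb_injective hinvc hinvp).sgpCap y)⁻¹ = u) →
      (ofConnectedTemperoidData h Q odd_l R ιX K' constEmb constEmb_injective hinvc hinvp).unitsToBirat
          (ofConnectedTemperoidData h Q odd_l R ιX K' constEmb constEmb_injective hinvc hinvp).BN u ∈
        (ofConnectedTemperoidData h Q odd_l R ιX K' constEmb constEmb_injective hinvc hinvp).constEmb.range) :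
    (ofConnectedTemperoidData h Q odd_l R ιX K' constEmb constEmb_injective hinvc hinvp).Facts :=
  facts_ofConnectedTemperoidData h Q odd_l R ιX K' constEmb constEmb_injective hinvc hinvp
    (BiKummerSetting.hH_mkOfConnectedTemperoidYdd X tf hZ hP NH T ιX) hconst hgc

end General

section ThetaDivisor

variable
  (hθ : ∀ x : X.Pi, pull tf.divisorMonoid ((BiKummerSetting.mkOfConnectedTemperoidYdd X tf hZ hP NH T ιX).galoisSurj
    (BiKummerSetting.mkOfConnectedTemperoidYdd X tf hZ hP NH T ιX).Aodot.base
    (BiKummerSetting.mkOfConnectedTemperoidYdd X tf hZ hP NH T ιX).isGalois_Aodot x).hom (ModelFrobenioid.div Pl.num) =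
      ModelFrobenioid.div Pl.num)
  (hθ' : ∀ x : X.Pi, pull tf.divisorMonoid ((BiKummerSetting.mkOfConnectedTemperoidYdd X tf hZ hP NH T ιX).galoisSurj
    (BiKummerSetting.mkOfConnectedTemperoidYdd X tf hZ hP NH T ιX).Aodot.base
    (BiKummerSetting.mkOfConnectedTemperoidYdd X tf hZ hP NH T ιX).isGalois_Aodot x).hom (ModelFrobenioid.div Pl.den) =
      ModelFrobenioid.div Pl.den)

/-- **`Facts` for the §5 data over `B^temp(Π^tp_X)⁰` with `A_⊙^bs := Ÿ` and the divisor inputs supplied from the `Π^tp_X`-stability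
of `Div(Θ̈)_±`** — inputs exactly `h, Q, (Rl, R), ιX, (K', constEmb), hθ, hθ', hconst, hgc`.
[cite: MochizukiEtTh2009, §5 p.330–331 (PDF pp.104–105); Prop 4.3 (i) p.317 (PDF p.91); Lem 5.8 p.331 (PDF p.105)] -/
theorem facts_ofConnectedTemperoidYddData_thetaDivisor
    (hconst : ∀ (e : Aut R.BN) (k : K'ˣ), tf.biratAutModel R.BN e (constEmb k) = constEmb k)
    (hgc : ∀ u : (ofConnectedTemperoidData h Q odd_l R ιX K' constEmb constEmb_injective
          (hinvc_ofConnectedTemperoid h R hθ) (hinvp_ofConnectedTemperoid h R ιX hθ')).units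
        (ofConnectedTemperoidData h Q odd_l R ιX K' constEmb constEmb_injective
          (hinvc_ofConnectedTemperoid h R hθ) (hinvp_ofConnectedTemperoid h R ιX hθ')).BN,
      (∀ y ∈ (ofConnectedTemperoidData h Q odd_l R ιX K' constEmb constEmb_injective
          (hinvc_ofConnectedTemperoid h R hθ) (hinvp_ofConnectedTemperoid h R ιX hθ')).imPiY,
        (ofConnectedTemperoidData h Q odd_l R ιX K' constEmb constEmb_injective
            (hinvc_ofConnectedTemperoid h R hθ) (hinvp_ofConnectedTemperoid h R ιX hθ')).sgpCap y *
          (u : Aut (ofConnectedTemperoidData h Q odd_l R ιX K' constEmb constEmb_injective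
            (hinvc_ofConnectedTemperoid h R hθ) (hinvp_ofConnectedTemperoid h R ιX hθ')).BN) *
          ((ofConnectedTemperoidData h Q odd_l R ιX K' constEmb constEmb_injective
            (hinvc_ofConnectedTemperoid h R hθ) (hinvp_ofConnectedTemperoid h R ιX hθ')).sgpCap y)⁻¹ = u) →
      (ofConnectedTemperoidData h Q odd_l R ιX K' constEmb constEmb_injective
          (hinvc_ofConnectedTemperoid h R hθ) (hinvp_ofConnectedTemperoid h R ιX hθ')).unitsToBirat
          (ofConnectedTemperoidData h Q odd_l R ιX K' constEmb constEmb_injective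
            (hinvc_ofConnectedTemperoid h R hθ) (hinvp_ofConnectedTemperoid h R ιX hθ')).BN u ∈
        (ofConnectedTemperoidData h Q odd_l R ιX K' constEmb constEmb_injective
          (hinvc_ofConnectedTemperoid h R hθ) (hinvp_ofConnectedTemperoid h R ιX hθ')).constEmb.range) :
    (ofConnectedTemperoidData h Q odd_l R ιX K' constEmb constEmb_injective
      (hinvc_ofConnectedTemperoid h R hθ) (hinvp_ofConnectedTemperoid h R ιX hθ')).Facts :=
  facts_ofConnectedTemperoidYddData h Q odd_l R K' constEmb constEmb_injective _ _ hconst hgc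

end ThetaDivisor

end ThetaFrobenioid

end Literature.AnabelianGeometry.EtaleTheta

end
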